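import Summits.BirchSwinnertonDyer.BirchSwinnertonDyer.Theorems.TeichmullerTwistDescentStarInvolution
import Summits.BirchSwinnertonDyer.BirchSwinnertonDyer.Theorems.TeichmullerTwistDescentPrincipalSeriesCells
import Summits.BirchSwinnertonDyer.BirchSwinnertonDyer.Theorems.AdditiveKolyvaginRoadManinFrameTransport
import Summits.BirchSwinnertonDyer.BirchSwinnertonDyer.Theorems.AdditiveKolyvaginRoadManinFrameResidueProperRTameTwistPotGood
import Summits.BirchSwinnertonDyer.Rank1Residual.Additive.SubGordHigherOrdinary
import Summits.BirchSwinnertonDyer.Rank1Residual.Additive.PotentiallyOrdinaryTypeG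
import Summits.BirchSwinnertonDyer.Rank1Residual.Additive.DictionaryUniform
import HarnessLib

/-!
# Route `TeichmullerTwistDescent`, cruxes SCMU57 (stmt-BirchSwinnertonDyer-22639) and PSMU
# (stmt-BirchSwinnertonDyer-22638): THE STARRED HALVES OF THE `p ∈ {5, 7}` CELLS FOLLOW FROM THE
# UNSTARRED HALVES (star involution, `--supports`)

Cell `pub/bsd-wall` (D-0145 line route-BirchSwinnertonDyer-TeichmullerTwistDescent, rev 2), seat
`bsd-line-ttd-p1` (prover 1/2, g2, item SCMU57). THEOREMS ONLY (no definition, no named fact, no `sorry`);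
nothing is booked, no item is closed, BSD is not proved by this.

WHAT. The companion file `TeichmullerTwistDescentStarInvolution.lean` proved that the Manin `p`-part
TRANSFERS across the ramified quadratic twist `χ_{p*}` from the unstarred member of a star pair to the
starred one (`not_dvd_c_of_twist_datum`). Here this is run on the on-curve cells of
`TeichmullerTwistDescentPrincipalSeriesCells.lean` (seat ttd-p2):

* §1 `typeGOrd_iff_of_star_pair` — **the Weil type is preserved by the involution**: for a twist pair
  (`ord_p Δ_min(V) + 6 = ord_p Δ_min(W)`, both additive potentially good at `p ≥ 5`)
  `TypeGOrd W p ↔ TypeGOrd V p` (principal series ↔ principal series, supercuspidal ↔ supercuspidal):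
  both sides read `e ∣ p − 1` on the semistability defect (`typeG_iff_not_subM_and_semistabilityIndex_dvd`,
  `typeGOrd_of_addv_of_subGordHigher`), the involution exchanges `e = 3 ↔ 6` and fixes `e = 4`, and
  `3 ∣ p − 1 ↔ 6 ∣ p − 1` for odd `p`.
* §2 `exists_datum_not_dvd_of_forall_optimal` — a `p`-good conductor-level datum on a curve `V` with
  `E[p]` irreducible from the cell at the OPTIMAL curve of its class (Modularity for the optimal curve and
  Carayol; prime-to-`p` transport back, `ManinFrameTransport`).
* §3 **`cellSC57_of_unstarred`, `cellPS57_of_unstarred`** — granted Modularity, the cells (SC57) and (PS57)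
  (`p ∈ {5, 7}`, `W` optimal at the conductor level, additive, `E[p]` irreducible, no `Iₙ*` fibre at `(p)`,
  NOT / YES `(G)`-ordinary ⟹ `p ∤ c`) FOLLOW FROM THEIR RESTRICTIONS TO CLASSES WITH AN UNSTARRED MEMBER
  (`∃ V ∼ W` globally minimal with `ord_p Δ_min(V) < 6`; under Dokchitser–Dokchitser and `Irr` this is `W`
  itself of type II/III/IV — in print, not used). So of the six Kodaira cells of each Weil type only three
  carry content: SC {II, IV at `5`; III at `7`}, PS {III at `5`; II, IV at `7`}.
* §4 `supercuspidalOptimalManinUnitFiveSeven_of_unstarred_cell` — SCMU57 BY NAME from Modularity and the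
  unstarred supercuspidal cell (`supercuspidalOptimalManinUnitFiveSeven_of_cell` ∘ §3); a CONDITIONAL
  closer (T10: the crux as filed carries no Modularity antecedent).

HONEST STATUS. Nothing here proves a cell. Granted Kato's fact F″ the residual of both cells is already
unstarred (the torsion corners LOW = II at `5` and CORNER = III at `5`, II at `7` of route rev 2): the two
reductions are compatible and independent (this one uses no F″); their combination — "at most once" on LOW
and CORNER — is the companion file `TeichmullerTwistDescentStarInvolutionTorsionCorners.lean`.

References: [EdixhovenManin1991] Thm. 3, Prop. 6, §4; [SilvermanATAEC1994] IV Table 4.1;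
[DokchitserDokchitser2015LocalInvariants] Thm. 5.1 (1); [BCDTJAMS2001] Thm. A; [AgasheRibetStein2006] §2.
-/

set_option autoImplicit false
-- single-conjunct summit: `Summit.BirchSwinnertonDyer.BirchSwinnertonDyer.…` repeats the name by design
set_option linter.dupNamespace false

noncomputable section

open scoped Classical NumberField

open WeierstrassCurve IsDedekindDomain Rat.HeightOneSpectrum
  Literature.NumberTheory.EllipticCurves Literature.NumberTheory.EllipticCurves.ModularForms
  Literature.NumberTheory.EllipticCurves.Rank1Residual Literature.NumberTheory.DiophantineGeometry
  Summit.BirchSwinnertonDyer.Rank1Residual Summit.BirchSwinnertonDyer.Rank1Residual.Additive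
  Literature.NumberTheory.Automorphic
open Summit.BirchSwinnertonDyer.BirchSwinnertonDyer.Theorems.TeichmullerTwistDescent
open Summit.BirchSwinnertonDyer.BirchSwinnertonDyer.Theses.TeichmullerTwistDescent

namespace Summit.BirchSwinnertonDyer.BirchSwinnertonDyer.Theorems.TeichmullerTwistDescentStarInvolution

/-! ### §1 The Weil type across the star involution -/

section Gord

variable (p : ℕ) [hp : Fact p.Prime]

/-- **(G)-ordinarity across the star involution.** For a twist pair at `p ≥ 5` — `W`, `V` globally
minimal, both additive and potentially good at `p`, with `ord_p Δ_min(V) + 6 = ord_p Δ_min(W)` (types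
II/III/IV ↔ IV*/III*/II*) — `TypeGOrd W p ↔ TypeGOrd V p`. Both sides are `e ∣ p − 1` for the
semistability defect `e = 12/gcd(12, ord_p Δ_min) ∈ {3, 4, 6}` (tree: `TypeGOrd → TypeG →
e ∣ p − 1`, `typeG_iff_not_subM_and_semistabilityIndex_dvd`; conversely
`typeGOrd_of_addv_of_subGordHigher`), and the involution exchanges `e = 3` with `e = 6` and fixes
`e = 4`, while `3 ∣ p − 1 ↔ 6 ∣ p − 1` for odd `p`. [cite: EdixhovenManin1991, Prop. 6]
[cite: SilvermanATAEC1994, IV Table 4.1 (PDF p. 365)] -/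
theorem typeGOrd_iff_of_star_pair (hp5 : 5 ≤ p) (W V : WeierstrassCurve ℚ) [W.IsElliptic]
    [W.IsGloballyMinimal] [V.IsElliptic] [V.IsGloballyMinimal] (hW : Addv W p) (hV : Addv V p)
    (hjW : 0 ≤ padicValRat p W.j) (hjV : 0 ≤ padicValRat p V.j)
    (hord : padicValInt p V.minimalDiscriminantInt + 6 = padicValInt p W.minimalDiscriminantInt) :
    TypeGOrd W p ↔ TypeGOrd V p := by
  have hp2 : p ≠ 2 := by omega
  have h2 : 2 ∣ p - 1 := by
    obtain ⟨k, hk⟩ := hp.out.odd_of_ne_two hp2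
    exact ⟨k, by omega⟩
  have hvW := padicValInt_minimalDiscriminantInt_mem_of_addv_of_padicValRat_j_nonneg W p hp5 hW hjW
  have hvV := padicValInt_minimalDiscriminantInt_mem_of_addv_of_padicValRat_j_nonneg V p hp5 hV hjV
  have hcW : CondExpTwo W p := condExpTwo_of_addv_of_five_le W p hp5 hW
  have hcV : CondExpTwo V p := condExpTwo_of_addv_of_five_le V p hp5 hV
  -- the three cases `(ord V, ord W) ∈ {(2,8), (3,9), (4,10)}` and the two defects
  have hcases : (padicValInt p V.minimalDiscriminantInt = 2 ∧ padicValInt p W.minimalDiscriminantInt = 8) ∨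
      (padicValInt p V.minimalDiscriminantInt = 3 ∧ padicValInt p W.minimalDiscriminantInt = 9) ∨
      (padicValInt p V.minimalDiscriminantInt = 4 ∧ padicValInt p W.minimalDiscriminantInt = 10) := by
    omega
  -- `e ∣ p − 1` transfers both ways, and `e ≠ 2` on both sides
  have key : (semistabilityIndex W p ∣ p - 1 ↔ semistabilityIndex V p ∣ p - 1) ∧
      semistabilityIndex W p ≠ 2 ∧ semistabilityIndex V p ≠ 2 := by
    unfold semistabilityIndex
    rcases hcases with ⟨hv, hw⟩ | ⟨hv, hw⟩ | ⟨hv, hw⟩ <;> rw [hv, hw] <;> norm_num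
    · -- `e(W) = 3`, `e(V) = 6`
      constructor
      · intro h3
        exact Nat.Coprime.mul_dvd_of_dvd_of_dvd (by norm_num) h2 h3
      · intro h6
        exact dvd_trans (by norm_num) h6
    · -- `e(W) = 6`, `e(V) = 3`
      constructor
      · intro h6
        exact dvd_trans (by norm_num) h6
      · intro h3
        exact Nat.Coprime.mul_dvd_of_dvd_of_dvd (by norm_num) h2 h3
  obtain ⟨hiff, hneW, hneV⟩ := key
  constructor
  · intro hG
    have hdvd : semistabilityIndex W p ∣ p - 1 :=
      ((typeG_iff_not_subM_and_semistabilityIndex_dvd W p hp5).mp hG.typeG).2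
    exact typeGOrd_of_addv_of_subGordHigher V p hp5 hV
      ⟨⟨not_lt.mpr hjV, hcV, hiff.mp hdvd⟩, hneV⟩
  · intro hG
    have hdvd : semistabilityIndex V p ∣ p - 1 :=
      ((typeG_iff_not_subM_and_semistabilityIndex_dvd V p hp5).mp hG.typeG).2
    exact typeGOrd_of_addv_of_subGordHigher W p hp5 hW
      ⟨⟨not_lt.mpr hjW, hcW, hiff.mpr hdvd⟩, hneW⟩


end Gord

/-! ### §2 A `p`-good datum on a curve from a cell at the optimal curve of its class -/

section Transport

/-- A conductor-level statement about the data of `V₀`, applied at an equal level. [folklore] -/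
theorem not_dvd_c_of_level_eq {V₀ : WeierstrassCurve ℚ} {p : ℕ} {N M : ℕ} [NeZero N] [NeZero M]
    (hNM : N = M)
    (h : ∀ D : ModularParametrizationData V₀ N,
      (∀ z ∈ D.L.lattice, ∃ w ∈ periodLattice D.f, z = D.c * w) → ¬ (p : ℤ) ∣ D.c)
    (D : ModularParametrizationData V₀ M)
    (hopt : ∀ z ∈ D.L.lattice, ∃ w ∈ periodLattice D.f, z = D.c * w) : ¬ (p : ℤ) ∣ D.c := by
  subst hNM
  exact h D hopt

variable (p : ℕ) [hp : Fact p.Prime]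

/-- **A `p`-good datum on `V` from the cell at the OPTIMAL curve of its class.** Granted Modularity
(`hnf`): if `E[p]` is irreducible on `V` and the lattice-optimal conductor-level data of every globally
minimal `V₀ ∼ V` have `p ∤ c`, then `V` itself carries a conductor-level datum with `p ∤ c` — the
optimal curve of the class exists (`exists_optimal_modularParametrizationData_of_isNewformOf'`, with
`latticeEq_of_forall_modularDegree_le`), its level is the conductor (Carayol,
`IsNewformOf.level_eq_conductorNorm_of_exists_isNewformOf`), and the datum moves back to `V` along the
prime-to-`p` isogeny (`ManinFrameTransport.exists_modularParametrizationData_not_dvd_of_partner`).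
[cite: BCDTJAMS2001, Thm. A] [cite: AgasheRibetStein2006, Thm. 2.6 and §2] -/
theorem exists_datum_not_dvd_of_forall_optimal (hnf : exists_isNewformOf)
    (V : WeierstrassCurve ℚ) [V.IsElliptic] [V.IsGloballyMinimal] [NeZero (V.conductorNorm ℤ)]
    (hirr : Irr V p)
    (hcell : ∀ (V₀ : WeierstrassCurve ℚ) [V₀.IsElliptic] [V₀.IsGloballyMinimal]
      [NeZero (V₀.conductorNorm ℤ)] (D₀ : ModularParametrizationData V₀ (V₀.conductorNorm ℤ)),
      IsIsogenous V V₀ → (∀ z ∈ D₀.L.lattice, ∃ w ∈ periodLattice D₀.f, z = D₀.c * w) →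
      ¬ (p : ℤ) ∣ D₀.c) :
    ∃ D' : ModularParametrizationData V (V.conductorNorm ℤ), ¬ (p : ℤ) ∣ D'.c := by
  obtain ⟨f, hf⟩ := hnf V
  obtain ⟨V₀, hE₀, hM₀, D₀, hf₀, hiso, hmin⟩ :=
    exists_optimal_modularParametrizationData_of_isNewformOf' (V.conductorNorm ℤ) V rfl hf
  haveI := hE₀
  haveI := hM₀
  haveI : NeZero (V₀.conductorNorm ℤ) := ⟨(conductorNorm_pos_holds V₀).ne'⟩
  have hopt₀ : ∀ z ∈ D₀.L.lattice, ∃ w ∈ periodLattice D₀.f, z = D₀.c * w :=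
    D₀.latticeEq_of_forall_modularDegree_le fun W₂ _ D₂ h2 ↦ hmin W₂ D₂ (h2.trans hf₀)
  have hNV₀ : V.conductorNorm ℤ = V₀.conductorNorm ℤ :=
    IsNewformOf.level_eq_conductorNorm_of_exists_isNewformOf hnf D₀.isNewformOf
  have hc₀ : ¬ (p : ℤ) ∣ D₀.c :=
    not_dvd_c_of_level_eq hNV₀.symm (fun D hD ↦ hcell V₀ D hiso hD) D₀ hopt₀
  exact ManinFrameTransport.exists_modularParametrizationData_not_dvd_of_partner V hp.out hirr hiso D₀
    hc₀

end Transport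

/-! ### §3 The starred halves of the `p ∈ {5, 7}` cells follow from the unstarred halves -/

section Cells

variable (p : ℕ) [hp : Fact p.Prime]

/-- **Core of the involution on a cell.** Let `W` be globally minimal, `p ≥ 5`, additive at `p` with
`E[p]` irreducible, no `Iₙ*` fibre at `(p)`, of STARRED type (`6 < ord_p Δ_min(W)`), with a
lattice-optimal datum `D` at its conductor level. Suppose (the unstarred half of the cell, at the
twist): for every globally minimal model `C • W^{(p*)} = V` (additive, potentially good, of the
unstarred type `ord_p Δ_min(V) + 6 = ord_p Δ_min(W)`) and every globally minimal `V₀ ∼ V`, the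
lattice-optimal conductor-level data of `V₀` have `p ∤ c`. Then `p ∤ c(D)`. Assembly of
`unstarred_twist_of_starred`, `exists_datum_not_dvd_of_forall_optimal` (needs Modularity `hnf`) and
`not_dvd_c_of_twist_datum`. [cite: EdixhovenManin1991, §4 (typescript L602–640)] -/
theorem not_dvd_c_of_starred_of_unstarredCell (hnf : exists_isNewformOf) (hp5 : 5 ≤ p)
    (W : WeierstrassCurve ℚ) [W.IsElliptic] [W.IsGloballyMinimal] [NeZero (W.conductorNorm ℤ)]
    (hadd : Addv W p) (hirr : Irr W p) (hjW : 0 ≤ padicValRat p W.j)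
    (h6 : 6 < padicValInt p W.minimalDiscriminantInt)
    (D : ModularParametrizationData W (W.conductorNorm ℤ))
    (hopt : ∀ z ∈ D.L.lattice, ∃ w ∈ periodLattice D.f, z = D.c * w)
    (hcell : ∀ (V : WeierstrassCurve ℚ) [V.IsElliptic] [V.IsGloballyMinimal] (C : VariableChange ℚ),
      C • W.quadraticTwist ((-1 : ℚ) ^ (p / 2) * p) = V → Addv V p → 0 ≤ padicValRat p V.j →
      padicValInt p V.minimalDiscriminantInt + 6 = padicValInt p W.minimalDiscriminantInt →
      padicValInt p V.minimalDiscriminantInt ≤ 4 →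
      ∀ (V₀ : WeierstrassCurve ℚ) [V₀.IsElliptic] [V₀.IsGloballyMinimal] [NeZero (V₀.conductorNorm ℤ)]
        (D₀ : ModularParametrizationData V₀ (V₀.conductorNorm ℤ)),
        IsIsogenous V V₀ → (∀ z ∈ D₀.L.lattice, ∃ w ∈ periodLattice D₀.f, z = D₀.c * w) →
        ¬ (p : ℤ) ∣ D₀.c) :
    ¬ (p : ℤ) ∣ D.c := by
  have hp2 : p ≠ 2 := by omega
  obtain ⟨V, hVe, hVm, C, hC⟩ := exists_minimal_twist_pStar p W
  haveI := hVe
  haveI := hVm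
  obtain ⟨haddV, hjV, hordV, hV4, hu⟩ := unstarred_twist_of_starred p hp5 W V hadd hjW h6 C hC
  have hirrV : Irr V p :=
    BurungaleSkinnerTianWan2024.hasIrreducibleModPGaloisRep_of_smul_eq_quadraticTwist W V p (pStar_ne_zero p) (C := C⁻¹)
      (by rw [← hC, inv_smul_smul]) hirr
  haveI : NeZero (V.conductorNorm ℤ) := ⟨(conductorNorm_pos_holds V).ne'⟩
  have hNV : V.conductorNorm ℤ = W.conductorNorm ℤ :=
    conductorNorm_eq_of_twist_pStar p hp5 W V hadd haddV C hC
  obtain ⟨D', hc'⟩ := exists_datum_not_dvd_of_forall_optimal p hnf V hirrV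
    (fun V₀ _ _ _ D₀ hiso hopt₀ ↦ hcell V C hC haddV hjV hordV hV4 V₀ D₀ hiso hopt₀)
  exact not_dvd_c_of_twist_datum p hp2 W V hadd C hC hu D hopt
    (sq_dvd_conductorNorm_of_not_good_of_not_mult hadd) (dvd_of_eq hNV) D' hc'

/-- **(SC57) from its UNSTARRED half.** Granted Modularity (`hnf`), the supercuspidal on-curve cell
(SC57) of `TeichmullerTwistDescentPrincipalSeriesCells.lean` — `p ∈ {5, 7}`, `W` globally minimal with
a lattice-optimal datum at its conductor level, additive at `p`, `E[p]` irreducible, NOT `(G)`-ordinary,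
no `Iₙ*` fibre at `(p)` ⟹ `p ∤ c` — follows from the SAME statement restricted to classes containing
a globally minimal member `V` with `ord_p Δ_min(V) < 6` (the UNSTARRED supercuspidal types: II, IV at
`5`, III at `7`; by Dokchitser–Dokchitser and `Irr` this is `W` itself unstarred, in print). Proof: an
unstarred `W` is its own witness; a starred `W` is the optimal curve of the `χ_{p*}`-twist of an
unstarred supercuspidal class (`typeGOrd_iff_of_star_pair`, isogeny invariance of `Addv`, `Irr`,
`TypeGOrd`, `Iₙ*`-freeness), whose optimal curve has `p ∤ c` by hypothesis, and
`not_dvd_c_of_starred_of_unstarredCell` transfers. [cite: EdixhovenManin1991, §4]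
[cite: DokchitserDokchitser2015LocalInvariants, Thm. 5.1 (1)] -/
theorem cellSC57_of_unstarred (hnf : exists_isNewformOf)
    (hU : ∀ (W : WeierstrassCurve ℚ) [W.IsElliptic] [W.IsGloballyMinimal] (p : ℕ) [Fact p.Prime]
      [NeZero (W.conductorNorm ℤ)] (D : ModularParametrizationData W (W.conductorNorm ℤ)),
      (p = 5 ∨ p = 7) → Addv W p → Irr W p → ¬ TypeGOrd W p →
      (∀ n : ℕ, W.kodairaSymbolAt (placeOf p) ≠ .Istar n) →
      (∃ (V : WeierstrassCurve ℚ) (_ : V.IsElliptic) (_ : V.IsGloballyMinimal),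
        IsIsogenous W V ∧ padicValInt p V.minimalDiscriminantInt < 6) →
      (∀ z ∈ D.L.lattice, ∃ w ∈ periodLattice D.f, z = D.c * w) → ¬ (p : ℤ) ∣ D.c) :
    ∀ (W : WeierstrassCurve ℚ) [W.IsElliptic] [W.IsGloballyMinimal] (p : ℕ) [Fact p.Prime]
      [NeZero (W.conductorNorm ℤ)] (D : ModularParametrizationData W (W.conductorNorm ℤ)),
      (p = 5 ∨ p = 7) → Addv W p → Irr W p → ¬ TypeGOrd W p →
      (∀ n : ℕ, W.kodairaSymbolAt (placeOf p) ≠ .Istar n) →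
      (∀ z ∈ D.L.lattice, ∃ w ∈ periodLattice D.f, z = D.c * w) → ¬ (p : ℤ) ∣ D.c := by
  intro W _ _ p _ _ D hp57 hadd hirr hnG hnI hopt
  have hp5 : 5 ≤ p := by rcases hp57 with rfl | rfl <;> norm_num
  have hp2 : p ≠ 2 := by omega
  by_cases h6 : padicValInt p W.minimalDiscriminantInt < 6
  · exact hU W p D hp57 hadd hirr hnG hnI ⟨W, ‹_›, ‹_›, isIsogenous_self W, h6⟩ hopt
  have hjW : 0 ≤ padicValRat p W.j :=
    ManinFrameResidueProperRTameTwist.padicValRat_j_nonneg_of_addv_of_forall_kodairaSymbolAt_ne_Istar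
      W hp2 hadd (placeOf p) (natGenerator_placeOf p) hnI
  have h6' : 6 < padicValInt p W.minimalDiscriminantInt := by
    have := padicValInt_ne_six_of_forall_ne_Istar W p hp5 hadd hnI
    omega
  refine not_dvd_c_of_starred_of_unstarredCell p hnf hp5 W hadd hirr hjW h6' D hopt ?_
  intro V _ _ C hC haddV hjV hordV hV4 V₀ _ _ _ D₀ hiso hopt₀
  have hirrV : Irr V p :=
    BurungaleSkinnerTianWan2024.hasIrreducibleModPGaloisRep_of_smul_eq_quadraticTwist W V p (pStar_ne_zero p) (C := C⁻¹)
      (by rw [← hC, inv_smul_smul]) hirr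
  have hnGV : ¬ TypeGOrd V p := fun hG ↦
    hnG ((typeGOrd_iff_of_star_pair p hp5 W V hadd haddV hjW hjV hordV).mpr hG)
  have hnIV : ∀ n : ℕ, V.kodairaSymbolAt (placeOf p) ≠ .Istar n :=
    forall_ne_Istar_of_padicValInt_le_four V p hp5 haddV hV4
  exact hU V₀ p D₀ hp57 ((X2.addv_iff_of_isIsogenous hiso).mp haddV)
    ((X12.irr_iff_of_isIsogenous hiso p).mp hirrV)
    (fun hG ↦ hnGV ((typeGOrd_iff_of_isIsogenous hp2 haddV hiso).mpr hG))
    (forall_ne_Istar_of_member V₀ p hp2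
      ⟨V, ‹_›, ‹_›, hiso.symm_of_charZero, (forall_ne_Istar_iff_placeOf V p).mpr hnIV⟩)
    ⟨V, ‹_›, ‹_›, hiso.symm_of_charZero, by omega⟩ hopt₀

/-- **(PS57) from its UNSTARRED half** — the `(G)`-ordinary twin of `cellSC57_of_unstarred`: the
principal-series on-curve cell at `p ∈ {5, 7}` (`TypeGOrd W p`, the rest verbatim) follows, granted
Modularity, from its restriction to classes with an unstarred globally minimal member (types III at
`5`, II/IV at `7`). [cite: EdixhovenManin1991, §4 and Prop. 6] -/
theorem cellPS57_of_unstarred (hnf : exists_isNewformOf)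
    (hU : ∀ (W : WeierstrassCurve ℚ) [W.IsElliptic] [W.IsGloballyMinimal] (p : ℕ) [Fact p.Prime]
      [NeZero (W.conductorNorm ℤ)] (D : ModularParametrizationData W (W.conductorNorm ℤ)),
      (p = 5 ∨ p = 7) → Addv W p → Irr W p → TypeGOrd W p →
      (∀ n : ℕ, W.kodairaSymbolAt (placeOf p) ≠ .Istar n) →
      (∃ (V : WeierstrassCurve ℚ) (_ : V.IsElliptic) (_ : V.IsGloballyMinimal),
        IsIsogenous W V ∧ padicValInt p V.minimalDiscriminantInt < 6) →
      (∀ z ∈ D.L.lattice, ∃ w ∈ periodLattice D.f, z = D.c * w) → ¬ (p : ℤ) ∣ D.c) :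
    ∀ (W : WeierstrassCurve ℚ) [W.IsElliptic] [W.IsGloballyMinimal] (p : ℕ) [Fact p.Prime]
      [NeZero (W.conductorNorm ℤ)] (D : ModularParametrizationData W (W.conductorNorm ℤ)),
      (p = 5 ∨ p = 7) → Addv W p → Irr W p → TypeGOrd W p →
      (∀ n : ℕ, W.kodairaSymbolAt (placeOf p) ≠ .Istar n) →
      (∀ z ∈ D.L.lattice, ∃ w ∈ periodLattice D.f, z = D.c * w) → ¬ (p : ℤ) ∣ D.c := by
  intro W _ _ p _ _ D hp57 hadd hirr hG hnI hopt
  have hp5 : 5 ≤ p := by rcases hp57 with rfl | rfl <;> norm_num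
  have hp2 : p ≠ 2 := by omega
  by_cases h6 : padicValInt p W.minimalDiscriminantInt < 6
  · exact hU W p D hp57 hadd hirr hG hnI ⟨W, ‹_›, ‹_›, isIsogenous_self W, h6⟩ hopt
  have hjW : 0 ≤ padicValRat p W.j :=
    ManinFrameResidueProperRTameTwist.padicValRat_j_nonneg_of_addv_of_forall_kodairaSymbolAt_ne_Istar
      W hp2 hadd (placeOf p) (natGenerator_placeOf p) hnI
  have h6' : 6 < padicValInt p W.minimalDiscriminantInt := by
    have := padicValInt_ne_six_of_forall_ne_Istar W p hp5 hadd hnI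
    omega
  refine not_dvd_c_of_starred_of_unstarredCell p hnf hp5 W hadd hirr hjW h6' D hopt ?_
  intro V _ _ C hC haddV hjV hordV hV4 V₀ _ _ _ D₀ hiso hopt₀
  have hirrV : Irr V p :=
    BurungaleSkinnerTianWan2024.hasIrreducibleModPGaloisRep_of_smul_eq_quadraticTwist W V p (pStar_ne_zero p) (C := C⁻¹)
      (by rw [← hC, inv_smul_smul]) hirr
  have hGV : TypeGOrd V p := (typeGOrd_iff_of_star_pair p hp5 W V hadd haddV hjW hjV hordV).mp hG
  have hnIV : ∀ n : ℕ, V.kodairaSymbolAt (placeOf p) ≠ .Istar n :=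
    forall_ne_Istar_of_padicValInt_le_four V p hp5 haddV hV4
  exact hU V₀ p D₀ hp57 ((X2.addv_iff_of_isIsogenous hiso).mp haddV)
    ((X12.irr_iff_of_isIsogenous hiso p).mp hirrV)
    ((typeGOrd_iff_of_isIsogenous hp2 haddV hiso).mp hGV)
    (forall_ne_Istar_of_member V₀ p hp2
      ⟨V, ‹_›, ‹_›, hiso.symm_of_charZero, (forall_ne_Istar_iff_placeOf V p).mpr hnIV⟩)
    ⟨V, ‹_›, ‹_›, hiso.symm_of_charZero, by omega⟩ hopt₀

/-! ### §4 By name: SCMU57 from the unstarred supercuspidal cell -/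

/-- **The crux SCMU57 from its unstarred half, granted Modularity** — `SupercuspidalOptimalManinUnitFiveSeven`
follows from `hnf` and the UNSTARRED supercuspidal cell (binders of (SC57) plus "some globally minimal
member has `ord_p Δ_min < 6`"): `supercuspidalOptimalManinUnitFiveSeven_of_cell` ∘
`cellSC57_of_unstarred`. A CONDITIONAL closer (Modularity by name, as for every by-name closer of the
crux as filed — T10). What stays open: the unstarred cell itself (types II, IV at `5`, III at `7`).
[cite: EdixhovenManin1991, Thm. 3 (p > 7 only) and §4] [cite: BCDTJAMS2001, Thm. A] -/
theorem supercuspidalOptimalManinUnitFiveSeven_of_unstarred_cell (hnf : exists_isNewformOf)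
    (hU : ∀ (W : WeierstrassCurve ℚ) [W.IsElliptic] [W.IsGloballyMinimal] (p : ℕ) [Fact p.Prime]
      [NeZero (W.conductorNorm ℤ)] (D : ModularParametrizationData W (W.conductorNorm ℤ)),
      (p = 5 ∨ p = 7) → Addv W p → Irr W p → ¬ TypeGOrd W p →
      (∀ n : ℕ, W.kodairaSymbolAt (placeOf p) ≠ .Istar n) →
      (∃ (V : WeierstrassCurve ℚ) (_ : V.IsElliptic) (_ : V.IsGloballyMinimal),
        IsIsogenous W V ∧ padicValInt p V.minimalDiscriminantInt < 6) →
      (∀ z ∈ D.L.lattice, ∃ w ∈ periodLattice D.f, z = D.c * w) → ¬ (p : ℤ) ∣ D.c) :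
    SupercuspidalOptimalManinUnitFiveSeven :=
  supercuspidalOptimalManinUnitFiveSeven_of_cell hnf (cellSC57_of_unstarred hnf hU)

end Cells

end Summit.BirchSwinnertonDyer.BirchSwinnertonDyer.Theorems.TeichmullerTwistDescentStarInvolution

end
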